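import Summits.HodgeConjecture.CorCM.GaloisBalancedWeightDegenerate
import Summits.HodgeConjecture.CorCM.AbelianCMFieldsOddPartClassification
import Summits.HodgeConjecture.CorCM.OcticCMFieldAutomorphismsNondegenerate
import Mathlib.GroupTheory.SchurZassenhaus
import Mathlib.GroupTheory.Perm.Cycle.Type
import HarnessLib

/-!
# Galois CM fields of degree `2m`, `m` odd: every simple CM abelian variety is nondegenerate iff `m` is PRIME

COR-CM (cell `pub-hodgecm2`), binder seat b04 (gen 19), count-neutral claim GALOIS-TWICE-ODD, part IV (the theorem).
KERNEL ONLY: theorems; no definition, no named fact, no `sorry`.  `HC_CM` is neither used nor claimed: this is the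
Hodge conjecture for a NAMED class of CM abelian varieties and the existence of simple DEGENERATE ones (with
exceptional Hodge classes) for the complementary class, unconditionally.

**Theorem (`forall_isSimple_isNondegenerate_iff_of_twice_odd`).**  Let `K` be a CM field, Galois over `ℚ`, of degree
`[K : ℚ] = 2m` with `m` odd, `m > 1` (the Galois group is then `⟨c⟩ × Gal(K/k)` for the imaginary quadratic subfield
`k`, abelian or not).  Then

  every SIMPLE abelian variety with complex multiplication by `K` is nondegenerate   ⟺   `m` is prime.

`⟸` is Yanai's theorem (tree `Pohlmann1968.isNondegenerate_of_isPrimitive_of_prime`, by name; with the Hodge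
conjecture for all powers, `hodgeConjectureFor_pow_of_isSimple_of_twice_odd_prime`).  `⟹`
(`exists_isPrimitive_not_isNondegenerate_of_twice_odd`) is parts I–III: `⟨c⟩` has a complement `H` of odd order `m`
(Schur–Zassenhaus), `G = H ∪ cH`; a prime `p ∣ m`, `p < m`, gives `V ≤ H` cyclic of order `p ≥ 3` (Cauchy) and any
`y₀ ∈ H ∖ V` is a non-involution (odd order); the half system of a right transversal of `V` in `H` with trivial left
stabiliser is a PRIMITIVE DEGENERATE CM type.  Hence (`exists_simple_degenerate_of_twice_odd`) for `m` odd and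
COMPOSITE there is a simple CM abelian variety of dimension `m` with CM by `K` carrying an exceptional Hodge class on
some power — in particular (`…_of_not_isCyclic`, `…_of_not_comm`) whenever `Gal(K/ℚ)` is NOT CYCLIC, e.g. for every
NON-ABELIAN Galois group of twice-odd order (`ℤ/2 × (ℤ/7 ⋊ ℤ/3)` in degree `42`, `ℤ/2 × 3^{1+2}` in degree `54`,
`ℤ/2 × (ℤ/3 × ℤ/3)` in degree `18`, …).  For ABELIAN `K` this is gen 18's `AbelianOddPart` classification at
`a = 0`; the non-abelian Galois groups are new.

## References

* [Yanai1985] H. Yanai, *On the rank of CM-type*, Nagoya Math. J. 97 (1985), §4 Theorem.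
* [Dodson1984] B. Dodson, *The structure of Galois groups of CM-fields*, Trans. AMS 283 (1984), §3.1.1, §3.2.1, §3.3.1.
* [Gordon1999HodgeAVSurvey] B. B. Gordon, *A survey of the Hodge conjecture for abelian varieties*, Thm. 6.3–6.4, §9.4.3.
* [Rotman1995] J. J. Rotman, *An Introduction to the Theory of Groups*, Thm. 7.41 (Schur–Zassenhaus).
* [Shimura1998] G. Shimura, *Abelian Varieties with Complex Multiplication and Modular Functions*, §6.2 Thm. 3, §8.2 Prop. 26.
-/

noncomputable section

open CategoryTheory CategoryTheory.Limits NumberField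

namespace Summit.HodgeConjecture.CorCM.TwiceOdd

open Literature.NumberTheory.ComplexMultiplication
open Literature.AlgebraicGeometry.Motives (AbelianVariety CMType)
open Literature.AlgebraicGeometry.HodgeTheory
open Literature.AlgebraicGeometry.ComplexMultiplication (IsCMTypeRealisation isSimple_iff_isPrimitive)
open Literature.AlgebraicGeometry.Pohlmann1968
open Literature.Barriers.HodgeConjecture (divisorClassesSpan)
open Summit.HodgeConjecture.CorCM.GaloisOctic (complexConj_mul_comm complexConj_mul_self
  complexConj_restrictScalars_ne_one)
open Summit.HodgeConjecture.CorCM.AbelianSixteen (exists_simple_realisation_of_isPrimitive)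
open Summit.HodgeConjecture.CorCM.AbelianOddPart (forall_isSimple_iff_forall_isPrimitive)

open scoped Classical

variable {K : Type} [Field K] [NumberField K] [IsCMField K]

/-! ## §1 The complement of `⟨c⟩` in a Galois group of twice-odd order -/

section Group

variable {G : Type*} [Group G]

/-- **A central involution in a finite group of twice-odd order has a complement**: `|G| = 2m`, `m` odd, `c` central
with `c² = 1 ≠ c` ⟹ a subgroup `H` of order `m` with `c ∉ H` and `G = H ∪ cH` (Schur–Zassenhaus for the normal
subgroup `⟨c⟩` of order `2` and index `m`). [cite: Rotman1995, Thm. 7.41] -/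
theorem exists_complement_of_twice_odd [Finite G] {c : G} (hc1 : c ≠ 1) (hcc : c * c = 1)
    (hcz : ∀ g : G, c * g = g * c) {m : ℕ} (hm : Odd m) (hG : Nat.card G = 2 * m) :
    ∃ H : Subgroup G, c ∉ H ∧ (∀ g : G, g ∈ H ∨ c * g ∈ H) ∧ Nat.card H = m := by
  let N : Subgroup G := Subgroup.zpowers c
  -- `⟨c⟩ = {1, c}`
  have key : ∀ z ∈ N, z = 1 ∨ z = c := by
    intro z hz
    obtain ⟨k, rfl⟩ := Subgroup.mem_zpowers_iff.1 hz
    have hc2 : c ^ (2 : ℤ) = 1 := by rw [zpow_two, hcc]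
    rcases Int.even_or_odd k with ⟨j, hj⟩ | ⟨j, hj⟩
    · left
      rw [hj, ← two_mul, zpow_mul, hc2, one_zpow]
    · right
      rw [hj, zpow_add, zpow_mul, hc2, one_zpow, one_mul, zpow_one]
  haveI hNn : N.Normal := by
    refine ⟨fun n hn g => ?_⟩
    rcases key n hn with h1 | h1 <;> rw [h1]
    · rw [mul_one, mul_inv_cancel]; exact N.one_mem
    · rw [← hcz g, mul_assoc, mul_inv_cancel, mul_one]; exact Subgroup.mem_zpowers c
  haveI : Fact (Nat.Prime 2) := ⟨Nat.prime_two⟩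
  have horder : orderOf c = 2 := orderOf_eq_prime (by rw [pow_two, hcc]) hc1
  have hNcard : Nat.card N = 2 := by rw [Nat.card_zpowers, horder]
  have hNidx : N.index = m := by
    have h := N.index_mul_card
    rw [hNcard, hG] at h
    omega
  obtain ⟨H, hH⟩ := Subgroup.exists_right_complement'_of_coprime (N := N)
    (by rw [hNcard, hNidx]; exact Nat.coprime_two_left.2 hm)
  have hHcard : Nat.card H = m := by
    have h := hH.card_mul
    rw [hNcard, hG] at h
    omega
  have hcH : c ∉ H := fun h => hc1 (Subgroup.disjoint_def.1 hH.disjoint (Subgroup.mem_zpowers c) h)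
  refine ⟨H, hcH, fun g => ?_, hHcard⟩
  obtain ⟨⟨⟨n, hn⟩, ⟨q, hq⟩⟩, hnq, -⟩ := (Subgroup.isComplement'_def.1 hH).existsUnique g
  simp only at hnq
  rcases key n hn with h1 | h1
  · left
    rw [← hnq, h1, one_mul]; exact hq
  · right
    rw [← hnq, h1, ← mul_assoc, hcc, one_mul]; exact hq

/-- In a finite group of twice-odd order `2m` with a central involution: a subgroup `H` of order `m` with `m` PRIME is
cyclic and `G` is cyclic (`c·h` has order `2m` for a generator `h` of `H`). [folklore] -/
theorem isCyclic_of_twice_odd_prime [Finite G] {c : G} (hc1 : c ≠ 1) (hcc : c * c = 1)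
    (hcz : ∀ g : G, c * g = g * c) {m : ℕ} (hm : Odd m) (hp : m.Prime) (hG : Nat.card G = 2 * m) : IsCyclic G := by
  obtain ⟨H, hcH, -, hHcard⟩ := exists_complement_of_twice_odd hc1 hcc hcz hm hG
  haveI : Fact m.Prime := ⟨hp⟩
  haveI : Fact (Nat.Prime 2) := ⟨Nat.prime_two⟩
  haveI hHcyc : IsCyclic H := isCyclic_of_prime_card hHcard
  obtain ⟨h, hh⟩ := IsCyclic.exists_ofOrder_eq_natCard (α := H)
  rw [hHcard] at hh
  have hh' : orderOf (h : G) = m := by rw [Subgroup.orderOf_coe, hh]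
  have hc2 : orderOf c = 2 := orderOf_eq_prime (by rw [pow_two, hcc]) hc1
  have hm2 : Nat.Coprime 2 m := Nat.coprime_two_left.2 hm
  have hord : orderOf (c * (h : G)) = 2 * m := by
    rw [(show Commute c (h : G) from hcz h).orderOf_mul_eq_mul_orderOf_of_coprime (by rw [hc2, hh']; exact hm2),
      hc2, hh']
  exact isCyclic_of_orderOf_eq_card (c * (h : G)) (by rw [hord, hG])

end Group

/-! ## §2 Twice-odd composite degree ⟹ a primitive degenerate CM type -/

/-- **The subgroup data in twice-odd degree.**  `K/ℚ` Galois CM of degree `2m`, `m` odd, `p` a prime divisor of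
`m` with `p ≠ m`: a complement `H` of `⟨c⟩` (`c ∉ H`, `G = H ∪ cH`, `|H| = m`; Schur–Zassenhaus), a cyclic
`V ≤ H` of order `p ≥ 3` (Cauchy), and `y₀ ∈ H ∖ V`, necessarily with `y₀² ≠ 1` (odd order).
[cite: Rotman1995, Thm. 7.41] [cite: Dodson1984, §3.1.1] -/
theorem exists_subgroups_of_twice_odd [IsGalois ℚ K] {m : ℕ} (hm : Odd m) (hK : Module.finrank ℚ K = 2 * m)
    {p : ℕ} (hp : p.Prime) (hpm : p ∣ m) (hpm' : p ≠ m) :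
    ∃ (H V : Subgroup (K ≃ₐ[ℚ] K)) (y₀ : K ≃ₐ[ℚ] K), (IsCMField.complexConj K).restrictScalars ℚ ∉ H ∧
      (∀ g : K ≃ₐ[ℚ] K, g ∈ H ∨ (IsCMField.complexConj K).restrictScalars ℚ * g ∈ H) ∧ Nat.card H = m ∧
      V ≤ H ∧ Nat.card V = p ∧ 3 ≤ Nat.card V ∧ y₀ ∈ H ∧ y₀ ∉ V ∧ y₀ * y₀ ≠ 1 := by
  set c : K ≃ₐ[ℚ] K := (IsCMField.complexConj K).restrictScalars ℚ with hc_def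
  have hG : Nat.card (K ≃ₐ[ℚ] K) = 2 * m := by rw [IsGalois.card_aut_eq_finrank, hK]
  obtain ⟨H, hcH, hH, hHcard⟩ := exists_complement_of_twice_odd (c := c) complexConj_restrictScalars_ne_one
    complexConj_mul_self (fun g => complexConj_mul_comm g) hm hG
  -- `p` is odd, hence `≥ 3`, and `p < m`
  have hpodd : Odd p := hm.of_dvd_nat hpm
  have hp2 : p ≠ 2 := fun h => by rw [h] at hpodd; exact (by decide : ¬ Odd 2) hpodd
  have hp3 : 3 ≤ p := by have := hp.two_le; omega
  have hplt : p < m := lt_of_le_of_ne (Nat.le_of_dvd hm.pos hpm) hpm'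
  -- `V` cyclic of order `p` inside `H` (Cauchy)
  haveI : Fact p.Prime := ⟨hp⟩
  obtain ⟨x, hx⟩ := exists_prime_orderOf_dvd_card' (G := H) p (by rw [hHcard]; exact hpm)
  set V : Subgroup (K ≃ₐ[ℚ] K) := Subgroup.zpowers (x : K ≃ₐ[ℚ] K) with hV
  have hVH : V ≤ H := by rw [hV, Subgroup.zpowers_le]; exact x.2
  have hVcard : Nat.card V = p := by rw [hV, Nat.card_zpowers, Subgroup.orderOf_coe, hx]
  -- some `y₀ ∈ H ∖ V`, necessarily of odd order
  have hlt : V < H := lt_of_le_of_ne hVH fun h => by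
    have : Nat.card V = Nat.card H := by rw [h]
    rw [hVcard, hHcard] at this
    omega
  obtain ⟨y₀, hy₀H, hy₀V⟩ := SetLike.exists_of_lt hlt
  have hy₀2 : y₀ * y₀ ≠ 1 := by
    intro h
    have hodd : Odd (orderOf y₀) := hm.of_dvd_nat (hHcard ▸ H.orderOf_dvd_natCard hy₀H)
    have hdvd : orderOf y₀ ∣ 2 := orderOf_dvd_of_pow_eq_one (by rw [pow_two, h])
    rcases (Nat.dvd_prime Nat.prime_two).1 hdvd with h1 | h2
    · exact hy₀V (by rw [orderOf_eq_one_iff.1 h1]; exact V.one_mem)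
    · rw [h2] at hodd; exact (by decide : ¬ Odd 2) hodd
  exact ⟨H, V, y₀, hcH, hH, hHcard, hVH, hVcard, hVcard ▸ hp3, hy₀H, hy₀V, hy₀2⟩

/-- **`K/ℚ` Galois CM of degree `2m`, `m` odd and COMPOSITE (`m ≠ 1`, `m` not prime) ⟹ `K` has a PRIMITIVE
DEGENERATE CM type** (part III on the data of `exists_subgroups_of_twice_odd` for a prime `p ∣ m`, `p < m`).
[cite: Dodson1984, §3.1.1 and §3.2.1] [cite: Shimura1998, §8.2 Prop. 26] [cite: Gordon1999HodgeAVSurvey, §9.4.3] -/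
theorem exists_isPrimitive_not_isNondegenerate_of_twice_odd [IsGalois ℚ K] {m : ℕ} (hm : Odd m) (hm1 : m ≠ 1)
    (hmp : ¬ m.Prime) (hK : Module.finrank ℚ K = 2 * m) (φ₀ : K →+* ℂ) :
    ∃ Φ : CMType K, IsPrimitive (ℂ ≃+* ℂ) Φ.1 φ₀ ∧ ¬ IsNondegenerate Φ := by
  obtain ⟨p, hp, hpm⟩ := Nat.exists_prime_and_dvd hm1
  obtain ⟨H, V, y₀, hcH, hH, -, hVH, -, h3, hy₀H, hy₀V, hy₀2⟩ :=
    exists_subgroups_of_twice_odd hm hK hp hpm fun h => hmp (h ▸ hp)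
  exact exists_isPrimitive_not_isNondegenerate_of_subgroup H V hcH hH hVH h3 hy₀H hy₀V hy₀2 φ₀

/-! ## §3 The classification in twice-odd degree -/

/-- **`K/ℚ` Galois CM of degree `2m`, `m` odd, `m ≠ 1`: every PRIMITIVE CM type of `K` is nondegenerate ⟺ `m` is
prime** (`⟸` Yanai 1985 by name, `⟹` §2). [cite: Yanai1985, §4 Theorem (p. 171)] [cite: Dodson1984, §3.2.1]
[cite: Gordon1999HodgeAVSurvey, §9.4.3] -/
theorem forall_isPrimitive_isNondegenerate_iff_of_twice_odd [IsGalois ℚ K] {m : ℕ} (hm : Odd m) (hm1 : m ≠ 1)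
    (hK : Module.finrank ℚ K = 2 * m) (φ₀ : K →+* ℂ) :
    (∀ Φ : CMType K, IsPrimitive (ℂ ≃+* ℂ) Φ.1 φ₀ → IsNondegenerate Φ) ↔ m.Prime := by
  constructor
  · intro h
    by_contra hmp
    obtain ⟨Φ, hprim, hdeg⟩ := exists_isPrimitive_not_isNondegenerate_of_twice_odd hm hm1 hmp hK φ₀
    exact hdeg (h Φ hprim)
  · intro hp Φ hprim
    exact isNondegenerate_of_isPrimitive_of_prime hp hK φ₀ hprim

/-- **THE THEOREM (simple abelian varieties).**  `K/ℚ` Galois CM of degree `2m`, `m` odd, `m ≠ 1`: every SIMPLE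
abelian variety with complex multiplication by `K` is nondegenerate — `Hdg = Div` on all its powers, the Hodge
conjecture for all its powers — **iff `m` is prime**.  Covers every Galois group of twice-odd order, abelian
(`ℤ/2 × H`, gen 18) or not (`ℤ/2 × (ℤ/7 ⋊ ℤ/3)`, `ℤ/2 × 3^{1+2}_±`, `ℤ/2 × (ℤ/p ⋊ ℤ/q)`, …).
[cite: Yanai1985, §4 Theorem (p. 171)] [cite: Shimura1998, §6.2 Thm. 3 and §8.2 Prop. 26]
[cite: Gordon1999HodgeAVSurvey, Thm. 6.4 and §9.4.3] -/
theorem forall_isSimple_isNondegenerate_iff_of_twice_odd [IsGalois ℚ K] {m : ℕ} (hm : Odd m) (hm1 : m ≠ 1)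
    (hK : Module.finrank ℚ K = 2 * m) :
    (∀ (Φ : CMType K) (A : AbelianVariety ℂ) (ι : 𝓞 K →+* End A) (θ : K →+* Module.End ℂ (complexBetti A.X 1)),
        IsCMTypeRealisation Φ A ι θ → A.IsSimple → IsNondegenerate Φ) ↔ m.Prime := by
  obtain ⟨φ₀⟩ := (inferInstance : Nonempty (K →+* ℂ))
  rw [forall_isSimple_iff_forall_isPrimitive φ₀]
  exact forall_isPrimitive_isNondegenerate_iff_of_twice_odd hm hm1 hK φ₀

variable {Φ : CMType K} {A : AbelianVariety ℂ} {ι : 𝓞 K →+* End A} {θ : K →+* Module.End ℂ (complexBetti A.X 1)}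

/-- **Good case, `m` prime: the Hodge conjecture for every power of every SIMPLE abelian variety with CM by a Galois
CM field of degree `2p`** (Yanai/Tankeev–Ribet through the tree's nondegenerate-type theorem; unconditional).
[cite: Yanai1985, §4 Theorem and Remark (p. 172)] [cite: Gordon1999HodgeAVSurvey, Thm. 6.3–6.4] -/
theorem hodgeConjectureFor_pow_of_isSimple_of_twice_odd_prime {p : ℕ} (hp : p.Prime)
    (hK : Module.finrank ℚ K = 2 * p) (hA : IsCMTypeRealisation Φ A ι θ) (hs : A.IsSimple) (N : ℕ) :
    HodgeConjectureFor (⨁ fun _ : Fin N => A).dim (⨁ fun _ : Fin N => A).X := by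
  obtain ⟨φ₀⟩ := (inferInstance : Nonempty (K →+* ℂ))
  exact hodgeConjectureFor_pow_of_isPrimitive_of_prime hp hK φ₀ ((isSimple_iff_isPrimitive hA φ₀).1 hs) hA N

/-- **Bad case, `m` odd composite: a SIMPLE DEGENERATE CM abelian variety of dimension `m` with CM by `K`**, with an
exceptional Hodge class (rational, of type `(p,p)`, outside the complexified divisor ring) on some power.
[cite: Dodson1984, §3.2.1] [cite: Shimura1998, §6.2 Thm. 3 and §8.2 Prop. 26] [cite: Gordon1999HodgeAVSurvey, Thm. 6.4] -/
theorem exists_simple_degenerate_of_twice_odd [IsGalois ℚ K] {m : ℕ} (hm : Odd m) (hm1 : m ≠ 1) (hmp : ¬ m.Prime)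
    (hK : Module.finrank ℚ K = 2 * m) :
    ∃ (Φ : CMType K) (φ₀ : K →+* ℂ) (A : AbelianVariety ℂ) (ι : 𝓞 K →+* End A)
      (θ : K →+* Module.End ℂ (complexBetti A.X 1)),
      IsPrimitive (ℂ ≃+* ℂ) Φ.1 φ₀ ∧ ¬ IsNondegenerate Φ ∧ IsCMTypeRealisation Φ A ι θ ∧ A.IsSimple ∧ A.dim = m ∧
      ∃ n p : ℕ, ∃ x : complexBetti (⨁ fun _ : Fin n => A).X (2 * p), IsRationalClass x ∧
        IsOfHodgeType (⨁ fun _ : Fin n => A).dim (⨁ fun _ : Fin n => A).X (2 * p) p p x ∧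
        x ∉ divisorClassesSpan (⨁ fun _ : Fin n => A).X (⨁ fun _ : Fin n => A).dim p := by
  obtain ⟨φ₀⟩ := (inferInstance : Nonempty (K →+* ℂ))
  obtain ⟨Φ, hprim, hdeg⟩ := exists_isPrimitive_not_isNondegenerate_of_twice_odd hm hm1 hmp hK φ₀
  obtain ⟨A, ι, θ, hA, hs, hdim⟩ := exists_simple_realisation_of_isPrimitive Φ φ₀ hprim
  refine ⟨Φ, φ₀, A, ι, θ, hprim, hdeg, hA, hs, ?_, exists_exceptional_pow_of_not_isNondegenerate φ₀ hprim hdeg hA⟩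
  rw [hdim, hK, Nat.mul_div_cancel_left _ (by norm_num : 0 < 2)]

/-- **The dichotomy packaged**: for `K/ℚ` Galois CM of degree `2m`, `m` odd, `m ≠ 1`, EITHER `m` is prime and every
simple abelian variety with CM by `K` satisfies the Hodge conjecture together with all its powers, OR `m` is
composite and some simple abelian variety with CM by `K` carries an exceptional Hodge class on a power.
[cite: Yanai1985, §4 Theorem] [cite: Dodson1984, §3.2.1] [cite: Gordon1999HodgeAVSurvey, Thm. 6.3–6.4] -/
theorem hodgeConjectureFor_pow_or_exists_simple_degenerate_of_twice_odd [IsGalois ℚ K] {m : ℕ} (hm : Odd m)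
    (hm1 : m ≠ 1) (hK : Module.finrank ℚ K = 2 * m) :
    (m.Prime ∧ ∀ (Φ : CMType K) (A : AbelianVariety ℂ) (ι : 𝓞 K →+* End A)
        (θ : K →+* Module.End ℂ (complexBetti A.X 1)), IsCMTypeRealisation Φ A ι θ → A.IsSimple →
        ∀ N : ℕ, HodgeConjectureFor (⨁ fun _ : Fin N => A).dim (⨁ fun _ : Fin N => A).X) ∨
    (¬ m.Prime ∧ ∃ (Φ : CMType K) (φ₀ : K →+* ℂ) (A : AbelianVariety ℂ) (ι : 𝓞 K →+* End A)
      (θ : K →+* Module.End ℂ (complexBetti A.X 1)),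
      IsPrimitive (ℂ ≃+* ℂ) Φ.1 φ₀ ∧ ¬ IsNondegenerate Φ ∧ IsCMTypeRealisation Φ A ι θ ∧ A.IsSimple ∧ A.dim = m ∧
      ∃ n p : ℕ, ∃ x : complexBetti (⨁ fun _ : Fin n => A).X (2 * p), IsRationalClass x ∧
        IsOfHodgeType (⨁ fun _ : Fin n => A).dim (⨁ fun _ : Fin n => A).X (2 * p) p p x ∧
        x ∉ divisorClassesSpan (⨁ fun _ : Fin n => A).X (⨁ fun _ : Fin n => A).dim p) := by
  by_cases hp : m.Prime
  · exact Or.inl ⟨hp, fun Φ A ι θ hA hs N => hodgeConjectureFor_pow_of_isSimple_of_twice_odd_prime hp hK hA hs N⟩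
  · exact Or.inr ⟨hp, exists_simple_degenerate_of_twice_odd hm hm1 hp hK⟩

/-! ## §4 Non-cyclic, in particular non-abelian, Galois groups of twice-odd order -/

/-- **`K/ℚ` Galois CM of degree `2m`, `m` odd, with NON-CYCLIC Galois group ⟹ a simple DEGENERATE CM abelian variety
of dimension `m` with CM by `K`** (if `m` were prime, `Gal(K/ℚ) = ⟨c⟩ × C_p` would be cyclic).
[cite: Dodson1984, §3.2.1 and §3.3.1] [cite: Gordon1999HodgeAVSurvey, Thm. 6.4] -/
theorem exists_simple_degenerate_of_twice_odd_of_not_isCyclic [IsGalois ℚ K] {m : ℕ} (hm : Odd m)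
    (hK : Module.finrank ℚ K = 2 * m) (hG : ¬ IsCyclic (K ≃ₐ[ℚ] K)) :
    ∃ (Φ : CMType K) (φ₀ : K →+* ℂ) (A : AbelianVariety ℂ) (ι : 𝓞 K →+* End A)
      (θ : K →+* Module.End ℂ (complexBetti A.X 1)),
      IsPrimitive (ℂ ≃+* ℂ) Φ.1 φ₀ ∧ ¬ IsNondegenerate Φ ∧ IsCMTypeRealisation Φ A ι θ ∧ A.IsSimple ∧ A.dim = m ∧
      ∃ n p : ℕ, ∃ x : complexBetti (⨁ fun _ : Fin n => A).X (2 * p), IsRationalClass x ∧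
        IsOfHodgeType (⨁ fun _ : Fin n => A).dim (⨁ fun _ : Fin n => A).X (2 * p) p p x ∧
        x ∉ divisorClassesSpan (⨁ fun _ : Fin n => A).X (⨁ fun _ : Fin n => A).dim p := by
  have hG2 : Nat.card (K ≃ₐ[ℚ] K) = 2 * m := by rw [IsGalois.card_aut_eq_finrank, hK]
  have hm1 : m ≠ 1 := by
    rintro rfl
    haveI : Fact (Nat.Prime 2) := ⟨Nat.prime_two⟩
    exact hG (isCyclic_of_prime_card (p := 2) (by rw [hG2]))
  have hmp : ¬ m.Prime := fun hp => hG (isCyclic_of_twice_odd_prime complexConj_restrictScalars_ne_one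
    complexConj_mul_self (fun g => complexConj_mul_comm g) hm hp hG2)
  exact exists_simple_degenerate_of_twice_odd hm hm1 hmp hK

/-- **Every Galois CM field of twice-odd degree with NON-ABELIAN Galois group carries a simple DEGENERATE CM abelian
variety** of dimension `[K:ℚ]/2`, with an exceptional Hodge class on some power — e.g. Galois groups
`ℤ/2 × (ℤ/7 ⋊ ℤ/3)` (degree `42`), `ℤ/2 × 3^{1+2}_±` (degree `54`), `ℤ/2 × (ℤ/p ⋊ ℤ/q)`.
[cite: Dodson1984, §3.3.1] [cite: Gordon1999HodgeAVSurvey, Thm. 6.4 and §9.4.3] -/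
theorem exists_simple_degenerate_of_twice_odd_of_not_comm [IsGalois ℚ K] {m : ℕ} (hm : Odd m)
    (hK : Module.finrank ℚ K = 2 * m) (hG : ∃ g h : K ≃ₐ[ℚ] K, g * h ≠ h * g) :
    ∃ (Φ : CMType K) (φ₀ : K →+* ℂ) (A : AbelianVariety ℂ) (ι : 𝓞 K →+* End A)
      (θ : K →+* Module.End ℂ (complexBetti A.X 1)),
      IsPrimitive (ℂ ≃+* ℂ) Φ.1 φ₀ ∧ ¬ IsNondegenerate Φ ∧ IsCMTypeRealisation Φ A ι θ ∧ A.IsSimple ∧ A.dim = m ∧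
      ∃ n p : ℕ, ∃ x : complexBetti (⨁ fun _ : Fin n => A).X (2 * p), IsRationalClass x ∧
        IsOfHodgeType (⨁ fun _ : Fin n => A).dim (⨁ fun _ : Fin n => A).X (2 * p) p p x ∧
        x ∉ divisorClassesSpan (⨁ fun _ : Fin n => A).X (⨁ fun _ : Fin n => A).dim p := by
  refine exists_simple_degenerate_of_twice_odd_of_not_isCyclic hm hK fun hcyc => ?_
  obtain ⟨g, h, hgh⟩ := hG
  letI := IsCyclic.commGroup (α := K ≃ₐ[ℚ] K)
  exact hgh (mul_comm g h)

end Summit.HodgeConjecture.CorCM.TwiceOdd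

end
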